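import Summits.Ventures.YMGap.RobustBall.PlaquettePositivityResample
import Literature.MathematicalPhysics.QuantumFieldTheory.WilsonAxisSymmetry
import Literature.MathematicalPhysics.QuantumFieldTheory.LatticeGaugeStaticPotentialLimitProofs
import Literature.MathematicalPhysics.QuantumLattice.LatticeGaugeDLRGibbsProofs
import HarnessLib

/-!
# Venture YMGap, track ROBUST-BALL — plaquette positivity III: every limit state, every coupling

HONEST FRAMING. WHAT THIS IS: a venture file (cell `pub-ymgap`, track Y2, seat rb-p2 g3): LATTICE
statements about the infinite-volume limit states of Wilson's `SU(N)` lattice gauge theory (torus Wilson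
states `μ_{Λ_L, β}`, tree coupling `β`, weight `exp(-β S_W)`), valid at EVERY coupling `β > 0`.
WHAT IT IS NOT: nothing about the continuum limit, a spectral gap, or a Clay-sense mass gap.

MAIN RESULT (`integral_plaquetteObs_ge`, `rectExpectation_one_one_ge`, `rectExpectation_one_one_pos`):
for `G ≅ SU(N)`, `N ≥ 2` (`IsSpecialUnitaryModel ρ`), `d ≥ 2`, every `β > 0` and every infinite-volume
limit point `μ` of the torus Wilson states, the mean plaquette is bounded below EXPLICITLY:
`W_μ(1,1) = ⟨(1/N) Re tr ρ(U_p)⟩_μ ≥ β e^{-8(d-1)Nβ} V₀ / (2(d-1)N) > 0`, `V₀ = ∫_G (Re tr ρ)² dHaar`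
(`PlaquetteLowerBound.charVariance`, `> 0` by `charVariance_pos`). The tree's only non-vanishing
statement of this kind (`PlaquetteLowerBound.exists_rectExpectation_one_one_ge`, first-order polymer
expansion) is restricted to `0 < β ≤ β₂` with an astronomically small `β₂`; here there is NO smallness
condition on `β`.

MECHANISM: parts I–II give `∫ ∑_{p ∋ e₀} Re tr ρ(U_p) dμ ≥ β e^{-8(d-1)Nβ} V₀` for every DLR state;
limit points are DLR states (`mem_ymGibbsMeasures_of_mem_infiniteVolumeLimitPoints_holds`), and they are
invariant under lattice translations (`map_configShift_eq_of_mem`) and permutations of the axes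
(`map_configPermZd_eq_of_mem`, via the tree's `IsInfiniteVolumeLimitAlong.map_configPermZd`), so all
`2(d-1)` plaquettes through `e₀` have the expectation of the plaquette at the origin of the `(0,1)`
plane (`integral_plaquetteObs_eq`).

References: E. Seiler, LNP 159 (1982), §2 (the static potential needs non-vanishing loops);
H.-O. Georgii, *Gibbs Measures and Phase Transitions* (2011), Remark 1.24. Everything here is proved;
no definition, no named fact. [folklore]
-/

noncomputable section

open MeasureTheory Filter Topology Finset
open Literature.Probability.LatticeModels Literature.Probability.LatticeModels.DobrushinMetric
open Literature.MathematicalPhysics.QuantumLattice Literature.MathematicalPhysics.QuantumFieldTheory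

namespace Summit.Ventures.YMGap.RobustBall

namespace PlaquettePositivity

/-! ### Part F — limit points: symmetry, and the plaquette bound -/

section LimitPoints

variable {d N : ℕ} [NeZero d] {G : Type*} [Group G] [TopologicalSpace G] [IsTopologicalGroup G]
  [CompactSpace G] [MeasurableSpace G] [BorelSpace G] [SecondCountableTopology G] [T2Space G]
  (ρ : G →* Matrix (Fin N) (Fin N) ℂ)

omit [NeZero d] in
/-- **Infinite-volume limit points of the torus Wilson states are translation invariant** (the
torus states are, and bounded continuous cylinder integrals determine the measure; cf. the tree's
`isZdTranslationInvariant_of_mem_infiniteVolumeLimitPoints`, reproved here to keep the imports light).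
[folklore] -/
theorem map_configShift_eq_of_mem {β : ℝ} {μ : Measure (LGConfig d G)}
    (hμ : μ ∈ infiniteVolumeLimitPoints ρ β) (v : Literature.Probability.LatticeModels.Site d) :
    μ.map (Literature.MathematicalPhysics.QuantumLattice.configShift v) = μ := by
  obtain ⟨φ, hφ, hprob, hconv⟩ := hμ
  haveI := hprob
  haveI : IsProbabilityMeasure (μ.map (Literature.MathematicalPhysics.QuantumLattice.configShift v)) :=
    Measure.isProbabilityMeasure_map
      (Literature.MathematicalPhysics.QuantumLattice.configShift v).measurable.aemeasurable
  refine measure_eq_of_integral_cylinder_eq fun F S hFS hFc hFb => ?_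
  rw [integral_map_equiv]
  have h1 := hconv (F ∘ Literature.MathematicalPhysics.QuantumLattice.configShift v) _
    (IsCylinder.comp_configShift hFS v)
    (hFc.comp (continuous_configShift v))
    (by obtain ⟨C, hC⟩ := hFb; exact ⟨C, fun U => hC _⟩)
  have hE : ∀ k : ℕ, wilsonExpectation (L := φ k + 1) ρ β
      (toTorusObservable (φ k + 1) (F ∘ Literature.MathematicalPhysics.QuantumLattice.configShift v)) =
      wilsonExpectation (L := φ k + 1) ρ β (toTorusObservable (φ k + 1) F) := fun k => by
    rw [toTorusObservable_comp_configShift, wilsonExpectation_comp_torusConfigShift]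
  simp only [hE] at h1
  exact tendsto_nhds_unique h1 (hconv F S hFS hFc hFb)

omit [NeZero d] in
/-- **Infinite-volume limit points are invariant under permutations of the coordinate axes**
(`IsInfiniteVolumeLimitAlong.map_configPermZd`: the permuted measure is a limit along the SAME
subsequence). [folklore] -/
theorem map_configPermZd_eq_of_mem (hρ : Continuous ρ) {β : ℝ} {μ : Measure (LGConfig d G)}
    (hμ : μ ∈ infiniteVolumeLimitPoints ρ β) (π : Equiv.Perm (Fin d)) :
    μ.map (configPermZd π) = μ := by
  obtain ⟨φ, hφ, hlim⟩ := hμ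
  have hlim' := IsInfiniteVolumeLimitAlong.map_configPermZd ρ hρ hlim π
  haveI := hlim.1
  haveI := hlim'.1
  refine measure_eq_of_integral_cylinder_eq fun F S hFS hFc hFb => ?_
  exact tendsto_nhds_unique (hlim'.2 F S hFS hFc hFb) (hlim.2 F S hFS hFc hFb)

/-- Two prescribed values of a permutation of the axes: `σ 0 = i`, `σ 1 = j` for `i ≠ j`.
[folklore] -/
theorem exists_perm_apply_zero_one {i j : Fin d} (hij : i ≠ j) (h01 : (0 : Fin d) ≠ 1) :
    ∃ σ : Equiv.Perm (Fin d), σ 0 = i ∧ σ 1 = j := by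
  have hk : Equiv.swap (0 : Fin d) i j ≠ 0 := by
    rw [Ne, Equiv.swap_apply_eq_iff, Equiv.swap_apply_left]
    exact fun h => hij h.symm
  refine ⟨(Equiv.swap (1 : Fin d) (Equiv.swap (0 : Fin d) i j)).trans (Equiv.swap 0 i), ?_, ?_⟩
  · rw [Equiv.trans_apply, Equiv.swap_apply_of_ne_of_ne h01 hk.symm, Equiv.swap_apply_left]
  · rw [Equiv.trans_apply, Equiv.swap_apply_left, Equiv.swap_apply_self]

/-- **All plaquettes have the same expectation in a limit state**: translation invariance moves the
corner to the origin and a permutation of the axes moves the plane to `(0,1)`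
(`plaquetteObs_configPermZd`). [folklore] -/
theorem integral_plaquetteObs_eq (hρ : Continuous ρ) (hd : 2 ≤ d) {β : ℝ} {μ : Measure (LGConfig d G)}
    (hμ : μ ∈ infiniteVolumeLimitPoints ρ β) (y : Literature.Probability.LatticeModels.Site d)
    {i j : Fin d} (hij : i ≠ j) :
    ∫ U, plaquetteObs ρ y i j U ∂μ = ∫ U, plaquetteObs ρ 0 0 1 U ∂μ := by
  have h1 : ∫ U, plaquetteObs ρ y i j U ∂μ = ∫ U, plaquetteObs ρ 0 i j U ∂μ := by
    conv_lhs => rw [← map_configShift_eq_of_mem ρ hμ y]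
    rw [integral_map_equiv]
    refine integral_congr_ae (ae_of_all _ fun U => ?_)
    show plaquetteObs ρ y i j (Literature.MathematicalPhysics.QuantumLattice.configShift y U) =
      plaquetteObs ρ 0 i j U
    simp only [plaquetteObs, plaquetteHolonomyZd,
      Literature.MathematicalPhysics.QuantumLattice.configShift_apply, add_sub_right_comm, sub_self]
  obtain ⟨σ, hσ0, hσ1⟩ := exists_perm_apply_zero_one hij (TorusAreaLaw.fin_zero_ne_one hd)
  have h2 : ∫ U, plaquetteObs ρ 0 0 1 U ∂μ = ∫ U, plaquetteObs ρ 0 i j U ∂μ := by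
    conv_lhs => rw [← map_configPermZd_eq_of_mem ρ hρ hμ σ.symm]
    rw [integral_map_equiv]
    refine integral_congr_ae (ae_of_all _ fun U => ?_)
    show plaquetteObs ρ 0 0 1 (configPermZd σ.symm U) = plaquetteObs ρ 0 i j U
    rw [plaquetteObs_configPermZd, Equiv.symm_symm, hσ0, hσ1, sitePermZd_zero]
  rw [h1, h2]

/-- **PLAQUETTE POSITIVITY AT EVERY COUPLING.** For `G ≅ SU(N)`, `N ≥ 2`, `d ≥ 2`, every `β ≥ 0`
and every infinite-volume limit point `μ` of the torus Wilson states,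
`∫ Re tr ρ(U_p) dμ ≥ β e^{-8(d-1)Nβ} V₀ / (2(d-1))` for the plaquette `p` at the origin in the
`(0,1)` plane, `V₀ = charVariance ρ = ∫_G (Re tr ρ)² dHaar > 0`. [folklore] -/
theorem integral_plaquetteObs_ge (hρ : IsSpecialUnitaryModel ρ) (hN : 2 ≤ N) (hd : 2 ≤ d)
    {β : ℝ} (hβ : 0 ≤ β) {μ : Measure (LGConfig d G)} (hμ : μ ∈ infiniteVolumeLimitPoints ρ β) :
    β * Real.exp (-(8 * ((d : ℝ) - 1) * N * β)) * PlaquetteLowerBound.charVariance ρ / (2 * ((d : ℝ) - 1)) ≤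
      ∫ U, plaquetteObs ρ 0 0 1 U ∂μ := by
  have hG : μ ∈ ymGibbsMeasures ρ β :=
    mem_ymGibbsMeasures_of_mem_infiniteVolumeLimitPoints_holds ρ hρ.1 hμ
  obtain ⟨φ, hφ, hprob, hconv⟩ := id hμ
  haveI := hprob
  have hu := IsSpecialUnitaryModel.mem_unitaryGroup ρ hρ
  have h := integral_sum_plaquetteObs_ge ρ hρ hN hd hβ hG
  set p₀ : ZdPlaquette d := ((0 : Literature.Probability.LatticeModels.Site d),
    ⟨((0 : Fin d), (1 : Fin d)), fin_zero_lt_one hd⟩) with hp₀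
  set e₀ := plaqLink1 p₀ with he₀
  have hsum : ∫ U, ∑ p ∈ plaquettesTouching {e₀}, plaquetteObs ρ p.1 p.2.1.1 p.2.1.2 U ∂μ =
      (plaquettesTouching {e₀}).card * ∫ U, plaquetteObs ρ 0 0 1 U ∂μ := by
    rw [integral_finsetSum _ fun p _ => ?_]
    · rw [Finset.sum_congr rfl fun p _ => integral_plaquetteObs_eq ρ hρ.1 hd hμ p.1 (ne_of_lt p.2.2),
        Finset.sum_const, nsmul_eq_mul]
    · exact (continuous_plaquetteObs ρ hρ.1 _ _ _).integrable_of_hasCompactSupport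
        (HasCompactSupport.of_compactSpace _)
  have hce : ((plaquettesTouching {e₀}).card : ℝ) = 2 * ((d : ℝ) - 1) := by
    rw [Balaban1983to89.Sufficient.card_plaquettesTouching_singleton e₀]
    have h1 : 1 ≤ d := by omega
    push_cast [Nat.cast_sub h1]
    ring
  rw [hsum, hce] at h
  have hdpos : (0 : ℝ) < 2 * ((d : ℝ) - 1) := by
    have : (2 : ℝ) ≤ d := by exact_mod_cast hd
    linarith
  rw [div_le_iff₀ hdpos]
  linarith

/-- **`W_μ(1,1) > 0` at every coupling, quantitatively**: the normalised plaquette expectation of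
every limit state satisfies `W_μ(1,1) ≥ β e^{-8(d-1)Nβ} V₀ / (2(d-1)N)` (`G ≅ SU(N)`, `N ≥ 2`,
`d ≥ 2`, `β ≥ 0`). [folklore] -/
theorem rectExpectation_one_one_ge (hρ : IsSpecialUnitaryModel ρ) (hN : 2 ≤ N) (hd : 2 ≤ d)
    {β : ℝ} (hβ : 0 ≤ β) {μ : Measure (LGConfig d G)} (hμ : μ ∈ infiniteVolumeLimitPoints ρ β) :
    β * Real.exp (-(8 * ((d : ℝ) - 1) * N * β)) * PlaquetteLowerBound.charVariance ρ /
        (2 * ((d : ℝ) - 1) * N) ≤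
      rectExpectation μ (fun g => normalisedCharacter N (ρ g)) 0 1 1 1 := by
  have h := integral_plaquetteObs_ge ρ hρ hN hd hβ hμ
  have hN0 : (0 : ℝ) < N := by exact_mod_cast (show 0 < N by omega)
  have hdpos : (0 : ℝ) < 2 * ((d : ℝ) - 1) := by
    have : (2 : ℝ) ≤ d := by exact_mod_cast hd
    linarith
  have hW : rectExpectation μ (fun g => normalisedCharacter N (ρ g)) 0 1 1 1 =
      (N : ℝ)⁻¹ * ∫ U, plaquetteObs ρ 0 0 1 U ∂μ := by
    have hline : ∀ (U : LGConfig d G) (i : Fin d) (x : Literature.Probability.LatticeModels.Site d),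
        walkHolonomy U (lineWalk i 1 x) = U (x, i) := fun U i x => by
      rw [lineWalk, walkHolonomy_cons, walkHolonomy_copy, lineWalk, walkHolonomy_copy, walkHolonomy_nil,
        mul_one, dartHolonomy_add_single]
    have hhol : ∀ U : LGConfig d G, walkHolonomy U (rectWalk 0 0 1 1 1) = plaquetteHolonomyZd U 0 0 1 :=
      fun U => by
        simp only [rectWalk, walkHolonomy_append, walkHolonomy_copy, walkHolonomy_reverse, hline,
          Nat.cast_one, plaquetteHolonomyZd, mul_assoc]
    unfold rectExpectation loopExpectation wilsonLoopObs
    simp only [normalisedCharacter, plaquetteObs, hhol]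
    rw [integral_const_mul]
  rw [hW]
  rw [div_le_iff₀ (by positivity)] 
  rw [div_le_iff₀ hdpos] at h
  have : β * Real.exp (-(8 * ((d : ℝ) - 1) * N * β)) * PlaquetteLowerBound.charVariance ρ ≤
      ((N : ℝ)⁻¹ * ∫ U, plaquetteObs ρ 0 0 1 U ∂μ) * (2 * ((d : ℝ) - 1) * N) := by
    calc _ ≤ (∫ U, plaquetteObs ρ 0 0 1 U ∂μ) * (2 * ((d : ℝ) - 1)) := h
      _ = ((N : ℝ)⁻¹ * ∫ U, plaquetteObs ρ 0 0 1 U ∂μ) * (2 * ((d : ℝ) - 1) * N) := by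
          field_simp
  exact this

/-- **`W_μ(1,1) > 0` for every limit state at every `β > 0`.** [folklore] -/
theorem rectExpectation_one_one_pos (hρ : IsSpecialUnitaryModel ρ) (hN : 2 ≤ N) (hd : 2 ≤ d)
    {β : ℝ} (hβ : 0 < β) {μ : Measure (LGConfig d G)} (hμ : μ ∈ infiniteVolumeLimitPoints ρ β) :
    0 < rectExpectation μ (fun g => normalisedCharacter N (ρ g)) 0 1 1 1 := by
  refine lt_of_lt_of_le ?_ (rectExpectation_one_one_ge ρ hρ hN hd hβ.le hμ)
  have hV := PlaquetteLowerBound.charVariance_pos ρ hρ.1 (by omega)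
  have hN0 : (0 : ℝ) < N := by exact_mod_cast (show 0 < N by omega)
  have hdpos : (0 : ℝ) < 2 * ((d : ℝ) - 1) := by
    have : (2 : ℝ) ≤ d := by exact_mod_cast hd
    linarith
  positivity

end LimitPoints

end PlaquettePositivity

end Summit.Ventures.YMGap.RobustBall
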